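import Summits.KontsevichZagierPeriods.KontsevichZagierPeriods.Theses.Grothendieck
import Summits.KontsevichZagierPeriods.KontsevichZagierPeriods.Theorems.GpcLegendreLemniscatic.Negative.Canonical
import Literature.NumberTheory.Transcendental.KZRulesAssociator

/-!
# `LemniscaticSectorGlue` (stmt-KontsevichZagierPeriods-8612, route Grothendieck): the dimension count

The support item `KEAlgIndependent → GpcLegendreLemniscatic → LemniscaticSectorKernel` of route
`Grothendieck`: once `K = K(1/√2)` and `E = E(1/√2)` are algebraically independent over `ℚ`
(`KEAlgIndependent`, stmt-8611) and Legendre's relation `2EK − K² = π/2` is ONE move-derivable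
identity of the Kontsevich–Zagier calculus (`GpcLegendreLemniscatic`, crux stmt-0280), Conjecture 1
in kernel form holds on the whole sector ring `ℤ[K, E, π]`: every vanishing `ℤ`-combination of
lemniscatic monomial representations (type `(a, b, c)`: domain "first `a + b` coordinates in
`(0,1)`", integrand `∏ k(x_j) · ∏ e(x_{a+j}) · ∏ 1/(1 + x_{a+b+j}²)`) lies in `KZ.relations`.

## Proof (pure algebra over tree theorems; this file introduces no definitions)

Work in the formal period ring `P = FormalRep ⧸ relations` of
`Literature/NumberTheory/Transcendental/KZRulesAssociator.lean` (a `CommRing`; quotient map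
`KZ.toFormalPeriod`, evaluation `KZ.evalP : P →+* ℝ`, `⟦[r]⟧·⟦[s]⟧ = ⟦[r.prod s]⟧`). Write
`κ = ⟦[k]⟧`, `ε = ⟦[e]⟧` for the classes of the unit-interval representations `kRep`, `eRep` of
`Theorems/GpcLegendreLemniscatic/Negative/Canonical.lean`, and `ϖ = ⟦[p]⟧` for a representation
`p = [ℝ, 1/(1+x²)]` of `π` (`exists_piRep`).

1. *Canonical forms.* The iterated Fubini product `(k^a · e^b) · p^c` (`KZ.IntegralRep.prod`) has
   literally the domain and integrand of the item (`exists_monoRep`), so every admissible `r i` is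
   equivalent to it by the identity change of variables (`equivalent_of_eqOn`), and its class is
   `κᵃ εᵇ ϖᶜ`; hence `⟦Σ zᵢ [rᵢ]⟧ = ψ(P_z)` for the `ℤ`-algebra map
   `ψ = aeval (κ, ε, ϖ) : ℤ[x,y,z] → P` and `P_z = Σ zᵢ xᵃⁱ yᵇⁱ zᶜⁱ`, while
   `evalP ∘ ψ = aeval (K, E, π)` (`evalP_aeval`; Fubini is inside `evalP`, `value [p] = π`).
2. *Legendre in `P`.* From the crux (through `gpcLegendre_iff`): `⟦[g]⟧ κ = ⟦[ℝ, 1/(2(1+x²))]⟧`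
   with `g = 2e − k`; two integrand-additivity moves give `⟦[g]⟧ = 2ε − κ` and
   `ϖ = 2⟦[ℝ, 1/(2(1+x²))]⟧`, so `ψ(L) = 4κε − 2κ² − ϖ = 0` for `L = 4xy − 2x² − z`
   (`aeval_formalPeriod_legendre`).
3. *Division.* `L` has unit coefficient in `z`, so every `P ∈ ℤ[x,y,z]` is `Q·L + R(x,y)`
   (`exists_eq_mul_legendre_add`, induction on `P`). If `P(K, E, π) = 0` then, `L(K,E,π) = 0`
   being Legendre's relation (tree theorem `Lawden1989_eq_3_8_29_lemniscatic_holds`),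
   `R(K, E) = 0`, so `R = 0` by `KEAlgIndependent` (pushed from `ℤ` to `ℚ` coefficients by
   `MvPolynomial.map_injective`), `P = Q·L` and `ψ(P) = ψ(Q)·ψ(L) = 0`
   (`aeval_formalPeriod_eq_zero`).
4. `eval (Σ zᵢ[rᵢ]) = evalP ⟦Σ zᵢ[rᵢ]⟧ = P_z(K, E, π) = 0 ⇒ ⟦Σ zᵢ[rᵢ]⟧ = ψ(P_z) = 0 ⇒
   Σ zᵢ[rᵢ] ∈ relations` (`toFormalPeriod_eq_zero_iff`).

References: [Kontsevich–Zagier 2001, §1.2, §4.1] for the calculus and the product; [Lawden 1989,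
(3.8.29)] for Legendre's relation; [Chudnovsky 1984, Ch. 7] behind `KEAlgIndependent` (hypothesis).
-/

noncomputable section

open MeasureTheory Set
open Literature.NumberTheory.Transcendental
open Literature.NumberTheory.Transcendental.KZ
open Literature.ModelTheory.ExponentialFields (IsSemialgebraic)
open Literature.Analysis.SpecialFunctions (lemniscaticK lemniscaticE)
open MvPolynomial (aeval X C rename)
open Summit.KontsevichZagierPeriods.KontsevichZagierPeriods.Theses.Grothendieck
open Summit.KontsevichZagierPeriods.Grothendieck.GpcLegendreLemniscaticNegative

namespace Summit.KontsevichZagierPeriods.Grothendieck.LemniscaticSectorGlue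

/-! ## §1 The third factor `[ℝ, 1/(1+x²)]` (value `π`) -/

/-- **A representation `p = [ℝ, 1/(1 + x²)]` of `π` exists** (semialgebraic rational integrand,
integrable by Mathlib's `integrable_inv_one_add_sq`). [Kontsevich–Zagier 2001, §1.1] -/
theorem exists_piRep : ∃ p : IntegralRep 1, p.domain = univ ∧
    p.integrand = fun x => 1 / (1 + x 0 ^ 2) := by
  have hu : IsSemialgebraic ℚ (univ : Set (Fin 1 → ℝ)) :=
    Literature.ModelTheory.ExponentialFields.isSemialgebraic_univ
  have hf : IsSemialgebraicFunOn ℚ (univ : Set (Fin 1 → ℝ)) (fun x => 1 / (1 + x 0 ^ 2)) := by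
    have h := isSemialgebraicFunOn_aeval_div_aeval hu
      (1 : MvPolynomial (Fin 1) ℚ) (1 + X 0 ^ 2) (fun x _ => by
        simp only [map_add, map_one, map_pow, MvPolynomial.aeval_X]
        positivity)
    exact h.congr fun x _ => by
      simp only [map_add, map_one, map_pow, MvPolynomial.aeval_X]
  have hi : IntegrableOn (fun x : Fin 1 → ℝ => 1 / (1 + x 0 ^ 2)) univ := by
    rw [integrableOn_univ]
    have hg : Integrable (fun t : ℝ => 1 / (1 + t ^ 2)) := by
      refine integrable_inv_one_add_sq.congr (Filter.Eventually.of_forall fun t => ?_)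
      simp only [one_div]
    exact ((volume_preserving_funUnique (Fin 1) ℝ).integrable_comp_emb
      (MeasurableEquiv.measurableEmbedding _)).mpr hg
  exact ⟨⟨univ, fun x => 1 / (1 + x 0 ^ 2), hu, hf, hi⟩, rfl, rfl⟩

/-- **`[ℝ, 1/(1+x²)] − 2[ℝ, 1/(2(1+x²))]` is an integrand-additivity move**
(`1/(1+x²) = 1/(2(1+x²)) + 1/(2(1+x²))`). [Kontsevich–Zagier 2001, §1.2 rule (1)] -/
theorem of_piRep_sub_sub_mem (p : IntegralRep 1) (hpd : p.domain = univ)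
    (hpi : p.integrand = fun x => 1 / (1 + x 0 ^ 2)) :
    of p - of arctanRep - of arctanRep ∈ relations :=
  integrandAddRel_subset_relations ⟨1, p, arctanRep, arctanRep, by rw [hpd]; rfl,
    by rw [hpd]; rfl, fun x _ => by
    have hx : (1 + x 0 ^ 2 : ℝ) ≠ 0 := by positivity
    rw [hpi]
    show 1 / (1 + x 0 ^ 2) = 1 / (2 * (1 + x 0 ^ 2)) + 1 / (2 * (1 + x 0 ^ 2))
    field_simp
    norm_num, rfl⟩

/-- `⟦[ℝ, 1/(1+x²)]⟧ = 2·⟦[ℝ, 1/(2(1+x²))]⟧` in the formal period ring. [folklore] -/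
theorem toFormalPeriod_piRep (p : IntegralRep 1) (hpd : p.domain = univ)
    (hpi : p.integrand = fun x => 1 / (1 + x 0 ^ 2)) :
    toFormalPeriod (of p) = toFormalPeriod (of arctanRep) + toFormalPeriod (of arctanRep) := by
  have h := toFormalPeriod_eq_zero_of_mem (of_piRep_sub_sub_mem p hpd hpi)
  rw [map_sub, map_sub] at h
  linear_combination h

/-- `value [ℝ, 1/(1+x²)] = π` (from `value [ℝ, 1/(2(1+x²))] = π/2` and soundness of the move
`of_piRep_sub_sub_mem`). [Kontsevich–Zagier 2001, §1.1] -/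
theorem piRep_value (p : IntegralRep 1) (hpd : p.domain = univ)
    (hpi : p.integrand = fun x => 1 / (1 + x 0 ^ 2)) : p.value = Real.pi := by
  have h := relations_le_ker_eval_holds (of_piRep_sub_sub_mem p hpd hpi)
  rw [AddMonoidHom.mem_ker, map_sub, map_sub, eval_of, eval_of, arctanRep_value] at h
  linarith

/-! ## §2 `g = 2e − k` and Legendre's relation in the formal period ring -/

/-- **`⟦[g]⟧ = 2⟦[e]⟧ − ⟦[k]⟧`**: with the auxiliary representation `[(0,1), e + e]`, both
`[e + e] − [e] − [e]` and `[e + e] − [g] − [k]` are integrand-additivity moves (`g = 2e − k` on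
`(0,1)`, `gFun_eq`). [Kontsevich–Zagier 2001, §1.2 rule (1)] -/
theorem toFormalPeriod_gRep : toFormalPeriod (of gRep) =
    toFormalPeriod (of eRep) + toFormalPeriod (of eRep) - toFormalPeriod (of kRep) := by
  have hs : IsSemialgebraicFunOn ℚ unitIoo (fun x => eFun (x 0) + eFun (x 0)) :=
    (IsSemialgebraicFunOn.add_holds isSemialgebraicFunOn_eFun isSemialgebraicFunOn_eFun).congr
      fun _ _ => rfl
  obtain ⟨t, htd, hti⟩ : ∃ t : IntegralRep 1, t.domain = unitIoo ∧
      t.integrand = fun x => eFun (x 0) + eFun (x 0) :=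
    ⟨unitRep (fun t => eFun t + eFun t) hs (integrableOn_eFun.add integrableOn_eFun), rfl, rfl⟩
  have h1 : of t - of eRep - of eRep ∈ relations :=
    integrandAddRel_subset_relations ⟨1, t, eRep, eRep, by rw [htd]; rfl, by rw [htd]; rfl,
      fun x _ => by rw [hti]; rfl, rfl⟩
  have h2 : of t - of gRep - of kRep ∈ relations :=
    integrandAddRel_subset_relations ⟨1, t, gRep, kRep, by rw [htd]; rfl, by rw [htd]; rfl,
      fun x hx => by
        rw [htd] at hx
        rw [hti]
        show eFun (x 0) + eFun (x 0) = gFun (x 0) + kFun (x 0)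
        rw [gFun_eq hx]
        ring, rfl⟩
  have h1' := toFormalPeriod_eq_zero_of_mem h1
  have h2' := toFormalPeriod_eq_zero_of_mem h2
  rw [map_sub, map_sub] at h1' h2'
  linear_combination h1' - h2'

/-- **Legendre's relation, rules side, in `P`**: `⟦[g]⟧·⟦[k]⟧ = ⟦[ℝ, 1/(2(1+x²))]⟧` — the crux
`GpcLegendreLemniscatic` through its canonical instance (`gpcLegendre_iff`,
`[g]·[k] = legendreRep`). [Kontsevich–Zagier 2001, §1.2] -/
theorem toFormalPeriod_gRep_mul_kRep (h₂ : GpcLegendreLemniscatic) :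
    toFormalPeriod (of gRep) * toFormalPeriod (of kRep) = toFormalPeriod (of arctanRep) := by
  rw [toFormalPeriod_of_mul_of]
  exact (gpcLegendre_iff.mp h₂).toFormalPeriod_eq

/-! ## §3 Powers and the monomial representations -/

/-- **Powers of a one-dimensional representation.** For `s = [S, g]` and every `a` there is a
representation (the iterated Fubini product `(([pt,1]·s)·s)⋯s`) with domain the box `Sᵃ`, integrand
`∏ⱼ g(xⱼ)` and class `⟦[s]⟧ᵃ`. [Kontsevich–Zagier 2001, §4.1] -/
theorem exists_powRep (s : IntegralRep 1) {S : Set ℝ} {g : ℝ → ℝ} (hsd : s.domain = {x | x 0 ∈ S})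
    (hsi : s.integrand = fun x => g (x 0)) :
    ∀ a : ℕ, ∃ t : IntegralRep a, t.domain = {x | ∀ j, x j ∈ S} ∧
      (t.integrand = fun x => ∏ j, g (x j)) ∧ toFormalPeriod (of t) = toFormalPeriod (of s) ^ a
  | 0 => by
    refine ⟨IntegralRep.unit, ?_, ?_, ?_⟩
    · ext x
      simp only [IntegralRep.unit_domain, mem_univ, mem_setOf_eq, true_iff]
      exact fun j => j.elim0
    · funext x
      simp
    · rw [pow_zero, toFormalPeriod_of_unit]
  | a + 1 => by
    obtain ⟨t, htd, hti, htP⟩ := exists_powRep s hsd hsi a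
    refine ⟨t.prod s, ?_, ?_, ?_⟩
    · ext x
      rw [IntegralRep.prod_domain, IntegralRep.mem_prodDomain, htd, hsd, mem_setOf_eq, mem_setOf_eq,
        mem_setOf_eq, Fin.forall_fin_succ']
      exact Iff.rfl
    · funext x
      rw [IntegralRep.prod_integrand_eq, IntegralRep.prodFun_apply, hti, hsi,
        Fin.prod_univ_castSucc]
      exact rfl
    · rw [← toFormalPeriod_of_mul_of, htP, pow_succ]

/-- **The lemniscatic monomial representation of type `(a, b, c)` exists with the item's domain and
integrand, and has class `⟦[k]⟧ᵃ ⟦[e]⟧ᵇ ⟦[p]⟧ᶜ`**: it is `(k^a · e^b) · p^c` for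
`p = [ℝ, 1/(1+x²)]`. [Kontsevich–Zagier 2001, §4.1] -/
theorem exists_monoRep (p : IntegralRep 1) (hpd : p.domain = univ)
    (hpi : p.integrand = fun x => 1 / (1 + x 0 ^ 2)) (a b c : ℕ) :
    ∃ m : IntegralRep (a + b + c),
      m.domain = {x | ∀ j : Fin (a + b), x (Fin.castAdd c j) ∈ Ioo (0:ℝ) 1} ∧
      (m.integrand = fun x =>
        (∏ j : Fin a, (1 / Real.sqrt ((1 - x (Fin.castAdd c (Fin.castAdd b j)) ^ 2) *
          (1 - x (Fin.castAdd c (Fin.castAdd b j)) ^ 2 / 2)))) *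
        (∏ j : Fin b, (Real.sqrt (1 - x (Fin.castAdd c (Fin.natAdd a j)) ^ 2 / 2) /
          Real.sqrt (1 - x (Fin.castAdd c (Fin.natAdd a j)) ^ 2))) *
        ∏ j : Fin c, (1 / (1 + x (Fin.natAdd (a + b) j) ^ 2))) ∧
      toFormalPeriod (of m) =
        toFormalPeriod (of kRep) ^ a * toFormalPeriod (of eRep) ^ b * toFormalPeriod (of p) ^ c := by
  obtain ⟨tk, hkd, hki, hkP⟩ := exists_powRep kRep (S := Ioo (0:ℝ) 1) (g := kFun) rfl rfl a
  obtain ⟨te, hed, hei, heP⟩ := exists_powRep eRep (S := Ioo (0:ℝ) 1) (g := eFun) rfl rfl b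
  have hpd' : p.domain = {x | x 0 ∈ (univ : Set ℝ)} := by
    rw [hpd]
    exact Set.ext fun _ => ⟨fun _ => trivial, fun _ => trivial⟩
  obtain ⟨tp, hpd2, hpi2, hpP⟩ :=
    exists_powRep p (g := fun t => 1 / (1 + t ^ 2)) hpd' hpi c
  refine ⟨(tk.prod te).prod tp, ?_, ?_, ?_⟩
  · ext x
    simp only [IntegralRep.prod_domain, IntegralRep.mem_prodDomain, hkd, hed, hpd2, mem_setOf_eq,
      mem_univ, implies_true, and_true]
    constructor
    · rintro ⟨hk, he⟩ j
      refine Fin.addCases (fun i => ?_) (fun i => ?_) j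
      · exact hk i
      · exact he i
    · intro h
      exact ⟨fun i => h (Fin.castAdd b i), fun i => h (Fin.natAdd a i)⟩
  · funext x
    simp only [IntegralRep.prod_integrand_eq, IntegralRep.prodFun_apply, hki, hei, hpi2, kFun, eFun]
  · rw [← toFormalPeriod_of_mul_of, ← toFormalPeriod_of_mul_of, hkP, heP, hpP]

/-! ## §4 The sector map `ψ = aeval (⟦[k]⟧, ⟦[e]⟧, ⟦[p]⟧) : ℤ[x, y, z] → P` and its kernel -/

/-- **`evalP ∘ ψ = aeval (K, E, π)`**: both are ring maps `ℤ[x,y,z] → ℝ` with the same values on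
the variables (`evalP ⟦[k]⟧ = value [k] = K`, …, `value [p] = π`). [Kontsevich–Zagier 2001, §4.1] -/
theorem evalP_aeval (p : IntegralRep 1) (hpv : p.value = Real.pi) (P : MvPolynomial (Fin 3) ℤ) :
    evalP (aeval ![toFormalPeriod (of kRep), toFormalPeriod (of eRep), toFormalPeriod (of p)] P) =
      aeval ![lemniscaticK, lemniscaticE, Real.pi] P := by
  have h : evalP.comp (aeval ![toFormalPeriod (of kRep), toFormalPeriod (of eRep),
      toFormalPeriod (of p)]).toRingHom = (aeval ![lemniscaticK, lemniscaticE, Real.pi] :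
        MvPolynomial (Fin 3) ℤ →ₐ[ℤ] ℝ).toRingHom := by
    refine MvPolynomial.ringHom_ext (fun z => ?_) (fun i => ?_)
    · simp
    · fin_cases i <;> simp [kRep_value, eRep_value, hpv]
  exact RingHom.congr_fun h P

/-- **Division by `L = 4xy − 2x² − z`**: every `P ∈ ℤ[x,y,z]` is `Q·L + R(x,y)` with
`R ∈ ℤ[x,y]` (`L` has unit coefficient in `z`; induction on `P`, using `4xy − 2x² = z + L`).
[folklore] -/
theorem exists_eq_mul_legendre_add (P : MvPolynomial (Fin 3) ℤ) :
    ∃ (Q : MvPolynomial (Fin 3) ℤ) (R : MvPolynomial (Fin 2) ℤ),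
      P = Q * (4 * X 0 * X 1 - 2 * X 0 ^ 2 - X 2) + rename Fin.castSucc R := by
  have hL : rename Fin.castSucc (4 * X 0 * X 1 - 2 * X 0 ^ 2 : MvPolynomial (Fin 2) ℤ) =
      X 2 + (4 * X 0 * X 1 - 2 * X 0 ^ 2 - X 2 : MvPolynomial (Fin 3) ℤ) := by
    simp only [map_sub, map_mul, map_pow, MvPolynomial.rename_X, map_ofNat, Fin.castSucc_zero,
      Fin.castSucc_one]
    ring
  induction P using MvPolynomial.induction_on with
  | C a => exact ⟨0, C a, by simp⟩
  | add p q hp hq =>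
    obtain ⟨Q₁, R₁, rfl⟩ := hp
    obtain ⟨Q₂, R₂, rfl⟩ := hq
    exact ⟨Q₁ + Q₂, R₁ + R₂, by rw [map_add]; ring⟩
  | mul_X p i hp =>
    obtain ⟨Q, R, rfl⟩ := hp
    by_cases hi : i = Fin.last 2
    · subst hi
      refine ⟨Q * X 2 - rename Fin.castSucc R, R * (4 * X 0 * X 1 - 2 * X 0 ^ 2), ?_⟩
      rw [map_mul, hL, show (Fin.last 2 : Fin 3) = 2 from rfl]
      ring
    · obtain ⟨j, rfl⟩ := Fin.exists_castSucc_eq.mpr hi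
      exact ⟨Q * X (Fin.castSucc j), R * X j, by rw [map_mul, MvPolynomial.rename_X]; ring⟩

/-- **Legendre's relation, value side**: `L(K, E, π) = 4KE − 2K² − π = 0` (tree theorem
`Lawden1989_eq_3_8_29_lemniscatic_holds`, Lawden 1989, (3.8.29)). [folklore] -/
theorem aeval_real_legendre : aeval ![lemniscaticK, lemniscaticE, Real.pi]
    (4 * X 0 * X 1 - 2 * X 0 ^ 2 - X 2 : MvPolynomial (Fin 3) ℤ) = 0 := by
  have h := Literature.Analysis.SpecialFunctions.Lawden1989_eq_3_8_29_lemniscatic_holds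
  unfold Literature.Analysis.SpecialFunctions.Lawden1989_eq_3_8_29_lemniscatic at h
  simp only [map_sub, map_mul, map_pow, MvPolynomial.aeval_X, map_ofNat]
  simp only [Matrix.cons_val_zero, Matrix.cons_val_one, Matrix.head_cons, Matrix.cons_val_two,
    Matrix.tail_cons]
  linear_combination 2 * h

/-- **`ψ(L) = 0`** for `ψ = aeval (κ, ε, ϖ)`, `κ = ⟦[k]⟧`, `ε = ⟦[e]⟧`, `ϖ = ⟦[p]⟧`:
`4κε − 2κ² − ϖ = 2·(⟦[g]⟧κ − ⟦[r₀']⟧) − 2κ·(⟦[g]⟧ − 2ε + κ) − (ϖ − 2⟦[r₀']⟧) = 0` by the crux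
and the additivity moves of §§1–2. [Kontsevich–Zagier 2001, §1.2, §4.1] -/
theorem aeval_formalPeriod_legendre (h₂ : GpcLegendreLemniscatic) (p : IntegralRep 1)
    (hpd : p.domain = univ) (hpi : p.integrand = fun x => 1 / (1 + x 0 ^ 2)) :
    aeval ![toFormalPeriod (of kRep), toFormalPeriod (of eRep), toFormalPeriod (of p)]
      (4 * X 0 * X 1 - 2 * X 0 ^ 2 - X 2 : MvPolynomial (Fin 3) ℤ) = 0 := by
  have hleg := toFormalPeriod_gRep_mul_kRep h₂
  have hg := toFormalPeriod_gRep
  have hp := toFormalPeriod_piRep p hpd hpi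
  simp only [map_sub, map_mul, map_pow, MvPolynomial.aeval_X, map_ofNat]
  simp only [Matrix.cons_val_zero, Matrix.cons_val_one, Matrix.head_cons, Matrix.cons_val_two,
    Matrix.tail_cons]
  linear_combination 2 * hleg - 2 * toFormalPeriod (of kRep) * hg - hp

/-- **The kernel of the sector: `P(K, E, π) = 0 ⇒ ψ(P) = 0`.** Write `P = Q·L + R(x,y)`; then
`R(K, E) = P(K,E,π) − Q(K,E,π)·L(K,E,π) = 0`, so `R = 0` by algebraic independence of `K, E`
(`KEAlgIndependent`, pushed to `ℤ`-coefficients by `MvPolynomial.map_injective`), whence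
`ψ(P) = ψ(Q)·ψ(L) = 0` by `aeval_formalPeriod_legendre`. [folklore] -/
theorem aeval_formalPeriod_eq_zero (h₁ : KEAlgIndependent) (h₂ : GpcLegendreLemniscatic)
    (p : IntegralRep 1) (hpd : p.domain = univ) (hpi : p.integrand = fun x => 1 / (1 + x 0 ^ 2))
    (P : MvPolynomial (Fin 3) ℤ) (hP : aeval ![lemniscaticK, lemniscaticE, Real.pi] P = 0) :
    aeval ![toFormalPeriod (of kRep), toFormalPeriod (of eRep), toFormalPeriod (of p)] P = 0 := by
  obtain ⟨Q, R, rfl⟩ := exists_eq_mul_legendre_add P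
  rw [map_add, map_mul, aeval_real_legendre, mul_zero, zero_add, MvPolynomial.aeval_rename] at hP
  have h₁' : AlgebraicIndependent ℚ ![lemniscaticK, lemniscaticE] := h₁
  have hvec : ((![lemniscaticK, lemniscaticE, Real.pi] : Fin 3 → ℝ) ∘ Fin.castSucc) =
      ![lemniscaticK, lemniscaticE] := by
    funext i
    fin_cases i <;> rfl
  rw [hvec] at hP
  have hq : MvPolynomial.map (algebraMap ℤ ℚ) R = 0 := by
    apply h₁'
    rw [MvPolynomial.aeval_map_algebraMap, map_zero]
    exact hP
  have hR : R = 0 :=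
    MvPolynomial.map_injective (algebraMap ℤ ℚ) (algebraMap ℤ ℚ).injective_int
      (by rw [hq, map_zero])
  rw [hR, map_zero, add_zero, map_mul, aeval_formalPeriod_legendre h₂ p hpd hpi, mul_zero]

/-! ## §5 The glue -/

/-- **`LemniscaticSectorGlue`** (stmt-KontsevichZagierPeriods-8612): `KEAlgIndependent →
GpcLegendreLemniscatic → LemniscaticSectorKernel` — the dimension count closing the lemniscatic
sector `ℤ[K, E, π]` of Conjecture 1 in kernel form from ONE generator transfer (Legendre's relation)
and the proved transcendence degree. [Kontsevich–Zagier 2001, §1.2, §4.1] -/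
theorem lemniscaticSectorGlue_proof : LemniscaticSectorGlue := by
  intro h₁ h₂ ι _ z a b c r hdom hint heval
  obtain ⟨p, hpd, hpi⟩ := exists_piRep
  choose m hmd hmi hmP using fun i => exists_monoRep p hpd hpi (a i) (b i) (c i)
  have hEq : ∀ i, Equivalent (r i) (m i) := fun i =>
    equivalent_of_eqOn (r i) _ (by rw [hmd, hdom i]) (by rw [hmi]; exact hint i)
  have hS : toFormalPeriod (∑ i, z i • of (r i)) =
      aeval ![toFormalPeriod (of kRep), toFormalPeriod (of eRep), toFormalPeriod (of p)]
        (∑ i, z i • (X 0 ^ a i * X 1 ^ b i * X 2 ^ c i : MvPolynomial (Fin 3) ℤ)) := by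
    rw [map_sum, map_sum]
    refine Finset.sum_congr rfl fun i _ => ?_
    rw [map_zsmul, map_zsmul, (hEq i).toFormalPeriod_eq, hmP]
    simp only [map_mul, map_pow, MvPolynomial.aeval_X]
    rfl
  have hz : aeval ![lemniscaticK, lemniscaticE, Real.pi]
      (∑ i, z i • (X 0 ^ a i * X 1 ^ b i * X 2 ^ c i : MvPolynomial (Fin 3) ℤ)) = 0 := by
    rw [← evalP_aeval p (piRep_value p hpd hpi), ← hS, evalP_toFormalPeriod]
    exact heval
  rw [← toFormalPeriod_eq_zero_iff, hS]
  exact aeval_formalPeriod_eq_zero h₁ h₂ p hpd hpi _ hz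

end Summit.KontsevichZagierPeriods.Grothendieck.LemniscaticSectorGlue

end
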